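import Summits.AtomisticToContinuum.BoseEinsteinCondensation.Theses.BECZeroCrossingDilute
import Summits.AtomisticToContinuum.BoseEinsteinCondensation.Theorems.BECZeroCrossingDiluteNearIsotropicDiluteBECPenalisedPerron
import Summits.AtomisticToContinuum.BoseEinsteinCondensation.Theorems.BECZeroCrossingDiluteNearIsotropicDiluteBECPlanarDeficit
import Summits.AtomisticToContinuum.BoseEinsteinCondensation.Theorems.BECZeroCrossingDiluteNearIsotropicDiluteBECInterchangeComparison
import Summits.AtomisticToContinuum.BoseEinsteinCondensation.Theorems.BECZeroCrossingDiluteNearIsotropicDiluteBECKineticVariational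
import Literature.MathematicalPhysics.QuantumLattice.SpinChainsAkltCorrelationProofs
import Literature.MathematicalPhysics.QuantumLattice.SpinChargeKinematics
import HarnessLib

/-!
# The kinetic-gap (Gross–Pitaevskii) window of the crux `NearIsotropicDiluteBEC`
# (stub `stub_gapWindow` of line `birth`, item stmt-AtomisticToContinuum-13905, route BECZeroCrossingDilute)

**Theorem (half condensate in the kinetic-gap window).** There is `κ > 0` such that for every
`L ≥ 2`, every particle number `N` with `2N ≤ L³`, every anisotropy `0 ≤ Δ ≤ 1` with
`(1 − Δ)·N ≤ κ·L`, and every unit ground vector `ψ` of the penalised easy-plane XXZ ferromagnet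
`K_L(N,Δ) = H_Δ + 4L³(S³_tot + L³/2 − N)²` on `(ℤ/Lℤ)³` lying in the sector `S³_tot = N − L³/2`
(`H_Δ = −Σ_{⟨xy⟩}(S¹S¹ + S²S² + Δ S³S³)`, the `N`-boson sector of the hard-core lattice gas with
nearest-neighbour attraction `Δ`), the planar moment keeps half of the exact `SU(2)` condensate:
`N(L³ − N + 1) ≤ 2(Re⟨ψ,((S¹_tot)² + (S²_tot)²)ψ⟩ + N − L³/2) = 2⟨S⁺_tot S⁻_tot⟩_ψ`
(`stub_gapWindow`). Consequently the same holds for the TRACIAL ground-state functional of the crux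
(`nearIsotropicDiluteBEC_kineticGapWindow`): the crux `NearIsotropicDiluteBEC` restricted to the window
`(1 − Δ)N ≤ κL` — Lieb–Seiringer–Yngvason's Gross–Pitaevskii parameter `g ∝ a(Δ)N/L ∝ (1−Δ)N/L`
bounded by a small constant — is a theorem. What remains of the crux is the thermodynamic window
`κL ≤ (1−Δ)N` (stub `stub_thermodynamicWindow`, the `d = 3`, `T = 0` infrared problem).

Proof = composition of the three landed stubs of the line: B1 `stub_planarDeficit` (planar moment
`= N(L³−N+1) − ½Σ_{x,y}Re⟨ψ,(1−T_xy)ψ⟩`, `T_xy` the spin transposition), B2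
`stub_interchangeComparison` (all-pairs interchange Dirichlet form `≤ C₂L⁵ ×` nearest-neighbour one,
canonical paths on the torus, Diaconis–Saloff-Coste 1993), B3 `stub_kineticVariational`
(nearest-neighbour form of a sector ground vector `≤ C₃(1−Δ)N²/L³`, variational principle against the
uniform sector vector, Lieb–Seiringer–Solovej–Yngvason 2005 Ch. 5); with `κ = 1/(2C₂C₃)` the deficit is
`≤ C₂C₃(1−Δ)N·N L² ≤ ½NL³ ≤ N(L³−N+1)`. The tracial version adds stub A `stub_penalisedPerron`
(Perron–Frobenius: the ground space of `K_L(N,Δ)` is a line `ℂφ` inside the sector) and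
`groundStateFunctional_eq_of_hasUniqueGroundState`.
-/

noncomputable section

namespace Summit.AtomisticToContinuum.BoseEinsteinCondensation.Cruxes.NearIsotropicDiluteBEC.Birth

open scoped BigOperators Matrix ComplexOrder
open Literature.MathematicalPhysics.QuantumLattice Literature.Probability.LatticeModels Matrix Complex Finset

/-- **Stub B — half condensate in the kinetic-gap window** (registered signature, spelled in tree
vocabulary). There is `κ > 0` such that for `L ≥ 2`, `2N ≤ L³`, `0 ≤ Δ ≤ 1`, `(1−Δ)N ≤ κL`, every unit
sector ground vector `ψ` of `K_L(N,Δ)` satisfies `N(L³−N+1) ≤ 2(Re⟨ψ,Qψ⟩ + N − L³/2)`,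
`Q = (S¹_tot)² + (S²_tot)²`. Composition of the landed stubs B1, B2, B3 with `κ = 1/(2C₂C₃)`.
[folklore] -/
theorem stub_gapWindow :
    ∃ κ : ℝ, 0 < κ ∧ ∀ (L : ℕ) [NeZero L], 2 ≤ L → ∀ N : ℕ, 2 * (N : ℝ) ≤ (L : ℝ) ^ 3 →
      ∀ Δ : ℝ, 0 ≤ Δ → Δ ≤ 1 → (1 - Δ) * (N : ℝ) ≤ κ * (L : ℝ) →
      ∀ ψ : TensorIndex (TorusSite 3 L) 2 → ℂ,
        ψ ∈ (xxzHamiltonian 1 (torusGraph 3 L) (-1) Δ +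
          (((3 + 1) * L ^ 3 : ℕ) : ℂ) • (totalSpin 1 2 + ((L : ℂ) ^ 3 / 2 - (N : ℂ)) • 1) ^ 2).groundSpace →
        ((totalSpin 1 2 : Op (TorusSite 3 L) 2) + ((L : ℂ) ^ 3 / 2 - (N : ℂ)) • 1) *ᵥ ψ = 0 → star ψ ⬝ᵥ ψ = 1 →
        (N : ℝ) * ((L : ℝ) ^ 3 - N + 1) ≤
          2 * ((star ψ ⬝ᵥ ((totalSpin 1 0 : Op (TorusSite 3 L) 2) * totalSpin 1 0 + totalSpin 1 1 * totalSpin 1 1) *ᵥ ψ).re +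
            N - (L : ℝ) ^ 3 / 2) := by
  obtain ⟨C₂, hC₂, h2⟩ := stub_interchangeComparison
  obtain ⟨C₃, hC₃, h3⟩ := stub_kineticVariational
  refine ⟨1 / (2 * C₂ * C₃), by positivity, ?_⟩
  intro L _ hL N hN2 Δ hΔ0 hΔ1 hwin ψ hψmem hψsec hψ1
  have hL0 : (0 : ℝ) < (L : ℝ) := by exact_mod_cast (lt_of_lt_of_le (by norm_num) hL)
  have hL3 : (0 : ℝ) < (L : ℝ) ^ 3 := by positivity
  have hN0 : (0 : ℝ) ≤ (N : ℝ) := Nat.cast_nonneg N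
  have hNV' : (N : ℝ) ≤ (L : ℝ) ^ 3 := by linarith
  have hNV : N ≤ L ^ 3 := by exact_mod_cast hNV'
  -- the three parts at `ψ`
  have e1 := stub_planarDeficit L hL N hNV ψ hψsec hψ1
  set D : ℝ := ∑ x : TorusSite 3 L, ∑ y : TorusSite 3 L,
    (star ψ ⬝ᵥ ((1 : Op (TorusSite 3 L) 2) - permOp (Equiv.swap x y)) *ᵥ ψ).re with hD
  set K : ℝ := ∑ x : TorusSite 3 L, ∑ y : TorusSite 3 L,
    (if (torusGraph 3 L).Adj x y then
      (star ψ ⬝ᵥ ((1 : Op (TorusSite 3 L) 2) - permOp (Equiv.swap x y)) *ᵥ ψ).re else 0) with hK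
  have e2 : D ≤ C₂ * (L : ℝ) ^ 5 * K := h2 L hL ψ
  have e3 : K ≤ C₃ * (1 - Δ) * (N : ℝ) ^ 2 / (L : ℝ) ^ 3 := h3 L hL N hNV Δ hΔ0 hΔ1 ψ hψmem hψsec hψ1
  -- chain the bounds
  have hD1 : D ≤ C₂ * C₃ * ((1 - Δ) * (N : ℝ)) * (N : ℝ) * (L : ℝ) ^ 2 := by
    have hmono : C₂ * (L : ℝ) ^ 5 * K ≤ C₂ * (L : ℝ) ^ 5 * (C₃ * (1 - Δ) * (N : ℝ) ^ 2 / (L : ℝ) ^ 3) :=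
      mul_le_mul_of_nonneg_left e3 (by positivity)
    have heq : C₂ * (L : ℝ) ^ 5 * (C₃ * (1 - Δ) * (N : ℝ) ^ 2 / (L : ℝ) ^ 3) =
        C₂ * C₃ * ((1 - Δ) * (N : ℝ)) * (N : ℝ) * (L : ℝ) ^ 2 := by
      field_simp
    linarith
  have hD2 : D ≤ C₂ * C₃ * (1 / (2 * C₂ * C₃) * (L : ℝ)) * (N : ℝ) * (L : ℝ) ^ 2 := by
    have : C₂ * C₃ * ((1 - Δ) * (N : ℝ)) * (N : ℝ) * (L : ℝ) ^ 2 ≤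
        C₂ * C₃ * (1 / (2 * C₂ * C₃) * (L : ℝ)) * (N : ℝ) * (L : ℝ) ^ 2 := by
      have hcc : (0 : ℝ) ≤ C₂ * C₃ := by positivity
      have h' : C₂ * C₃ * ((1 - Δ) * (N : ℝ)) ≤ C₂ * C₃ * (1 / (2 * C₂ * C₃) * (L : ℝ)) :=
        mul_le_mul_of_nonneg_left hwin hcc
      have hNL : (0 : ℝ) ≤ (N : ℝ) * (L : ℝ) ^ 2 := by positivity
      nlinarith
    exact hD1.trans this
  have hD3 : D ≤ (N : ℝ) * (L : ℝ) ^ 3 / 2 := by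
    have heq : C₂ * C₃ * (1 / (2 * C₂ * C₃) * (L : ℝ)) * (N : ℝ) * (L : ℝ) ^ 2 =
        (N : ℝ) * (L : ℝ) ^ 3 / 2 := by
      field_simp
    linarith
  have hD4 : D ≤ (N : ℝ) * ((L : ℝ) ^ 3 - N + 1) := by
    have : (N : ℝ) * (L : ℝ) ^ 3 / 2 ≤ (N : ℝ) * ((L : ℝ) ^ 3 - N + 1) := by nlinarith
    exact hD3.trans this
  -- conclude with the identity B1
  rw [e1]
  linarith

/-- **The crux in its kinetic-gap window (tracial form).** There is `κ > 0` such that for `L ≥ 2`,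
`2N ≤ L³`, `0 ≤ Δ ≤ 1` and `(1−Δ)N ≤ κL` the tracial ground-state functional `ω` of
`K_L(N,Δ) = H_Δ + 4L³(S³_tot + L³/2 − N)²` satisfies the conclusion of `NearIsotropicDiluteBEC`
verbatim: `N(L³−N+1) ≤ 2(Re ω((S¹_tot)² + (S²_tot)²) + N − L³/2)`. From `stub_gapWindow` and the
Perron–Frobenius stub `stub_penalisedPerron` (the ground space is a line `ℂφ` inside the sector, so
`ω` is the vector state of the unit vector `φ`). [folklore] -/
theorem nearIsotropicDiluteBEC_kineticGapWindow :
    ∃ κ : ℝ, 0 < κ ∧ ∀ (L : ℕ) [NeZero L], 2 ≤ L → ∀ N : ℕ, 2 * (N : ℝ) ≤ (L : ℝ) ^ 3 →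
      ∀ Δ : ℝ, 0 ≤ Δ → Δ ≤ 1 → (1 - Δ) * (N : ℝ) ≤ κ * (L : ℝ) →
        (N : ℝ) * ((L : ℝ) ^ 3 - N + 1) ≤
          2 * (((xxzHamiltonian 1 (torusGraph 3 L) (-1) Δ +
            (((3 + 1) * L ^ 3 : ℕ) : ℂ) • (totalSpin 1 2 + ((L : ℂ) ^ 3 / 2 - (N : ℂ)) • 1) ^ 2).groundStateFunctional
              (totalSpin 1 0 * totalSpin 1 0 + totalSpin 1 1 * totalSpin 1 1)).re + N - (L : ℝ) ^ 3 / 2) := by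
  obtain ⟨κ, hκ, hP⟩ := stub_gapWindow
  refine ⟨κ, hκ, ?_⟩
  intro L _ hL N hN2 Δ hΔ0 hΔ1 hwin
  have hN0 : (0 : ℝ) ≤ (N : ℝ) := Nat.cast_nonneg N
  have hNV' : (N : ℝ) ≤ (L : ℝ) ^ 3 := by linarith
  have hNV : N ≤ L ^ 3 := by exact_mod_cast hNV'
  -- (A) the Perron vector of the penalised Hamiltonian
  obtain ⟨φ, _hφnn, hφ1, hφpen, hφmem, hφspan⟩ := stub_penalisedPerron L hL N hNV Δ hΔ0 hΔ1
  -- (B) vector-level persistence in the window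
  have key := hP L hL N hN2 Δ hΔ0 hΔ1 hwin φ hφmem hφpen hφ1
  -- the tracial ground-state functional is the vector state of `φ`
  set Kp : Op (TorusSite 3 L) 2 := xxzHamiltonian 1 (torusGraph 3 L) (-1) Δ +
    (((3 + 1) * L ^ 3 : ℕ) : ℂ) • (totalSpin 1 2 + ((L : ℂ) ^ 3 / 2 - (N : ℂ)) • 1) ^ 2 with hKp
  have hφ0 : φ ≠ 0 := by
    rintro rfl
    simp at hφ1
  have hspan : Kp.groundSpace = ℂ ∙ φ := by
    refine le_antisymm ?_ ?_
    · intro ψ hψ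
      obtain ⟨c, hc⟩ := hφspan ψ hψ
      rw [Submodule.mem_span_singleton]
      exact ⟨c, hc.symm⟩
    · rw [Submodule.span_le, Set.singleton_subset_iff]
      exact hφmem
  have huniq : Kp.HasUniqueGroundState := by
    show Module.finrank ℂ Kp.groundSpace = 1
    rw [hspan]
    exact finrank_span_singleton hφ0
  have hω : Kp.groundStateFunctional
      ((totalSpin 1 0 : Op (TorusSite 3 L) 2) * totalSpin 1 0 + totalSpin 1 1 * totalSpin 1 1) =
      star φ ⬝ᵥ ((totalSpin 1 0 : Op (TorusSite 3 L) 2) * totalSpin 1 0 + totalSpin 1 1 * totalSpin 1 1) *ᵥ φ := by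
    rw [groundStateFunctional_eq_of_hasUniqueGroundState huniq hφmem hφ0, hφ1, div_one]
  rw [hω]
  exact key

end Summit.AtomisticToContinuum.BoseEinsteinCondensation.Cruxes.NearIsotropicDiluteBEC.Birth

end
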